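import Literature.Geometry.Lorentzian.LeviCivita
import Literature.Geometry.Lorentzian.CurvatureProofs
import HarnessLib

/-!
# Brackets as commutators, and the symmetries of the curvature of a metric connection
(trunk T-LORENTZ / G08)

Companion of `Literature/Geometry/Lorentzian/CurvatureProofs.lean` (first Bianchi identity from
torsion-freeness). Four groups of results, all proved; the only new named fact is the regularity
statement `PseudoRiemannianMetric.isLocallyContMDiff_leviCivita` used to specialise them to the
Koszul-defined Levi-Civita connection of `LeviCivita.lean`:

1. **The Lie bracket acts on functions as the commutator of the derivations**
   (`Literature.Geometry.Lorentzian.mvfderiv_apply_mlieBracket`, proved): for `f : M → ℝ` of class `C²` at `x` and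
   vector fields `V`, `W` of class `C²` at `x` on a smooth real manifold,
   `df_x([V, W]_x) = V_x(W f) - W_x(V f)`. In Gallot–Hulin–Lafontaine 2004, Def. 1.52 bis, this is
   the *definition* of the bracket, the coordinate formula `[V, W]^i = V^j ∂_j W^i - W^j ∂_j V^i`
   displayed after it — Mathlib's definition of `VectorField.mlieBracket`, through charts — being
   derived from the Schwarz lemma. Mathlib has the identity on normed spaces
   (`VectorField.fderiv_apply_lieBracket`) but not on manifolds. The proof given here avoids a
   second chart computation: expand `[V, [W, f U]] - [W, [V, f U]]` for an auxiliary field `U`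
   with `U_x ≠ 0` by the product rule `[A, f B] = (A f) B + f [A, B]` (Mathlib's
   `VectorField.mlieBracket_smul_right`) and compare with the Jacobi identity (Mathlib's
   `VectorField.leibniz_identity_mlieBracket_apply`, whose proof contains the chart computation);
   the coefficient of `U_x` is the identity.
2. **The curvature of a metric-compatible connection is skew-adjoint**
   (`PseudoRiemannianMetric.val_curvature_skew`, proved): if a covariant derivative `∇` on `TM`
   is compatible with the `C^n` pseudo-Riemannian metric `g` (`g.IsCompatible ∇`, `n ≥ 2`) and
   locally `C¹`, then `g(R(X,Y)Z, W) = -g(R(X,Y)W, Z)` for its curvature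
   `R = CovariantDerivative.curvature ∇` — O'Neill 1983, Ch. 3, Prop. 3.36 (2) (stated there for
   the Levi-Civita connection; the printed proof, p. 75, uses only compatibility (D5));
   Gallot–Hulin–Lafontaine 2004, Prop. 3.5 i), second equality. Proof as printed: with
   `f = g(Z, Z)`, `2 g(R(X,Y)Z, Z) = X(Yf) - Y(Xf) - [X,Y]f = 0` (`val_curvature_self_eq_zero`),
   then polarize in `Z`.

   For the Levi-Civita connection `g.leviCivita` of `LeviCivita.lean` the two hypotheses are the
   contents of named facts: compatibility is (half of) `isLeviCivita_leviCivita` there, and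
   regularity — a `C^n` metric has a `C^{n-1}` Levi-Civita connection, read off the coordinate
   formula with Christoffel symbols, Gallot–Hulin–Lafontaine 2004, Prop. 2.54 — is vendored here
   as `isLocallyContMDiff_leviCivita`; `val_riemann_skew_of_facts` is the resulting statement for
   `g.riemann`, the hypothesis `riemann_skew` of the dimension-three step of
   `Literature/Geometry/Lorentzian/PositiveMassRigidity.lean`.

3. **Pair symmetry and symmetry of the Ricci tensor** (`PseudoRiemannianMetric.val_curvature_pair_symm`,
   `ricci_isSymm_of_isCompatible`, proved): for a torsion-free `g`-compatible locally `C¹`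
   connection, `g(R(X,Y)Z, W) = g(R(Z,W)X, Y)` (O'Neill 1983, Prop. 3.36 (4): from (1), (2) and
   the first Bianchi identity of `CurvatureProofs.lean`) and `Ric` is symmetric (O'Neill, Lemma
   3.52; trace in a `g_x`-orthogonal basis); whence the named fact `ricci_symm` of
   `LeviCivita.lean` follows from the two Levi-Civita facts (`ricci_symm_of_facts`).
4. **The Hessian of a `C²` function is symmetric** for a torsion-free Levi-Civita connection
   (`PseudoRiemannianMetric.hessian_isSymm_of_torsion_eq_zero`, proved; O'Neill 1983, Ch. 3,
   Lemma 3.49), whence the named fact `hessian_symm` of `LeviCivita.lean` follows from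
   `isLeviCivita_leviCivita` (`hessian_symm_of_isLeviCivita`).

Also proved: `PseudoRiemannianMetric.mdifferentiableAt_val_apply`, `contMDiffAt_val_apply` (the
scalar function `y ↦ g_y(A_y, B_y)` is differentiable, resp. `C^m`, at `x` when the fields `A`, `B`
are; pseudo-Riemannian analogues of Mathlib's `MDifferentiableAt.inner_bundle`),
`contMDiffAt_mvfderiv_apply` (`y ↦ df_y(W_y)` is `C¹` for `f` `C²` and `W` `C¹`) and
`mvfderiv_congr_of_eventuallyEq`.

## References

* [ONeill1983] B. O'Neill, *Semi-Riemannian geometry with applications to relativity*, Academic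
  Press 1983, Ch. 3, Thm. 3.11, Lemma 3.49 (Hessian), Prop. 3.36 (2), (4) and their proofs,
  pp. 75–76, Lemma 3.52 (Ricci).
* [GallotHulinLafontaine2004] S. Gallot, D. Hulin, J. Lafontaine, *Riemannian Geometry*, 3rd ed.,
  Universitext, Springer 2004: Def. 1.52 bis and Lemma 1.53 (bracket as commutator of
  derivations, coordinate formula, Jacobi identity), Thm. 2.51, Def. 2.53 and Prop. 2.54
  (Levi-Civita connection in coordinates, Christoffel symbols), Prop. 3.5 i) (symmetries of the
  curvature tensor), iii) (pair symmetry).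
* J. M. Lee, *Introduction to Riemannian Manifolds*, 2nd ed., Springer GTM 176, 2018, Prop. 7.12
  (symmetries of the curvature tensor), Prop. 7.14 ff. (Ricci).
-/

noncomputable section

open Bundle Set NormedSpace FiberBundle VectorField
open scoped Manifold ContDiff Topology

namespace Literature.Geometry.Lorentzian

variable {E : Type*} [NormedAddCommGroup E] [NormedSpace ℝ E] {H : Type*} [TopologicalSpace H]
  {I : ModelWithCorners ℝ E H} {M : Type*} [TopologicalSpace M] [ChartedSpace H M]
  [IsManifold I ∞ M] {n : ℕ∞ω} {x : M}

/-! ## The bracket acts on functions as the commutator of derivations -/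

omit [IsManifold I ∞ M] in
/-- Congruence of `mvfderiv` under eventual equality (Mathlib has `Filter.EventuallyEq.mfderiv_eq`
for `mfderiv`; `mvfderiv I f x` is `mfderiv` followed by the identification of the tangent space
of `ℝ` at `f x` with `ℝ`). [folklore] -/
theorem mvfderiv_congr_of_eventuallyEq {f f' : M → ℝ} (h : f =ᶠ[𝓝 x] f') :
    mvfderiv I f x = mvfderiv I f' x := by
  have h1 : mfderiv I 𝓘(ℝ, ℝ) f x = mfderiv I 𝓘(ℝ, ℝ) f' x := h.mfderiv_eq
  have h2 : f x = f' x := h.eq_of_nhds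
  unfold mvfderiv
  rw [h1, h2]

/-- For `f : M → ℝ` of class `C²` at `x` and a vector field `W` of class `C¹` at `x`, the function
`W f : y ↦ df_y(W_y)` is `C¹` at `x` (Mathlib's `ContMDiffAt.mfderiv_const` — the differential is
`C¹` in tangent coordinates — combined with `ContMDiffAt.clm_apply_of_inCoordinates`).
Gallot–Hulin–Lafontaine 2004, 1.49 and the remark following it (`L_ξ f = T_m f · ξ`; `C^{p-1}`
regularity for `f` of class `C^p`). [folklore] -/
theorem contMDiffAt_mvfderiv_apply {f : M → ℝ} {W : Π x : M, TangentSpace I x}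
    (hf : CMDiffAt 2 f x) (hW : CMDiffAt 1 (T% W) x) :
    CMDiffAt 1 (fun y ↦ mvfderiv I f y (W y)) x := by
  have h1 : CMDiffAt 1 (inTangentCoordinates I 𝓘(ℝ, ℝ) id f (mfderiv% f) x) x :=
    hf.mfderiv_const (m := 1) (by norm_num)
  have h2 : CMDiffAt 1 (fun y ↦ (mfderiv% f y (W y) :
      TotalSpace ℝ (TangentSpace 𝓘(ℝ, ℝ) : ℝ → Type _))) x :=
    ContMDiffAt.clm_apply_of_inCoordinates (b₁ := id) (b₂ := f) h1 hW (hf.of_le one_le_two)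
  exact ((contMDiff_snd_tangentBundle_modelSpace ℝ 𝓘(ℝ, ℝ) (n := 1)).contMDiffAt).comp x h2

/-- **The Lie bracket is the commutator of the derivations.** On a smooth real manifold `M`
(complete model space), for `f : M → ℝ` of class `C²` at `x` and vector fields `V`, `W` of class
`C²` at `x`: `df_x([V, W]_x) = V_x(W f) - W_x(V f)`, i.e.
`d f x (mlieBracket I V W x) = d (y ↦ d f y (W y)) x (V x) - d (y ↦ d f y (V y)) x (W x)` with
Mathlib's `mvfderiv` (`d`) and `VectorField.mlieBracket` (in charts
`[V, W]^i = V^j ∂_j W^i - W^j ∂_j V^i`). Gallot–Hulin–Lafontaine 2004, Def. 1.52 bis and the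
coordinate formula following it (there `L_V L_W - L_W L_V` is the definition of the bracket and the
coordinate formula is derived from the Schwarz lemma; Mathlib takes the coordinate formula as the
definition). Mathlib has the normed-space case (`VectorField.fderiv_apply_lieBracket`), not the
manifold case. *Proof given here* (not the printed one): if the model space is trivial all terms
vanish; otherwise pick `U₀ ≠ 0` in `T_x M`, extend it to a field `U` smooth near `x`, and expand
`[V, [W, f U]]_x` and `[W, [V, f U]]_x` with the product rule
`[A, f B] = (A f) B + f [A, B]` (near `x` inside, at `x` outside); subtracting and using the
Jacobi identity for `(V, W, f U)` and `(V, W, U)` (Gallot–Hulin–Lafontaine, Lemma 1.53; Mathlib's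
`leibniz_identity_mlieBracket_apply`) leaves `(V(Wf) - W(Vf) - [V,W] f)(x) • U₀ = 0`.
[cite: GallotHulinLafontaine2004, Def. 1.52 bis] -/
theorem mvfderiv_apply_mlieBracket [CompleteSpace E] {f : M → ℝ}
    {V W : Π x : M, TangentSpace I x}
    (hf : CMDiffAt 2 f x) (hV : CMDiffAt 2 (T% V) x) (hW : CMDiffAt 2 (T% W) x) :
    mvfderiv I f x (mlieBracket I V W x) =
      mvfderiv I (fun y ↦ mvfderiv I f y (W y)) x (V x)
        - mvfderiv I (fun y ↦ mvfderiv I f y (V y)) x (W x) := by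
  -- trivial model space: all tangent vectors vanish
  rcases subsingleton_or_nontrivial E with hE | hE
  · have h0 : ∀ v : TangentSpace I x, v = 0 := fun v ↦ Subsingleton.elim (α := E) v 0
    rw [h0 (mlieBracket I V W x), h0 (V x), h0 (W x)]
    simp
  obtain ⟨U₀, hU₀⟩ := exists_ne (0 : E)
  -- smoothness instances
  have hI3 : IsManifold I (minSmoothness ℝ 3) M := by
    rw [minSmoothness_of_isRCLikeNormedField]; infer_instance
  have hI2 : IsManifold I (minSmoothness ℝ 2) M := by
    rw [minSmoothness_of_isRCLikeNormedField]; infer_instance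
  have hI21 : IsManifold I (((2 : ℕ∞) : ℕ∞ω) + 1) M := IsManifold.of_le (n := ∞) (mod_cast le_top)
  have h2ms : minSmoothness ℝ 2 = 2 := minSmoothness_of_isRCLikeNormedField
  -- an auxiliary field `U` with `U x = U₀ ≠ 0`, `C²` on an open neighbourhood `u` of `x`
  obtain ⟨u, hu, hxu, hU2⟩ :=
    CovariantDerivative.exists_isOpen_contMDiffOn_extend (I := I) (x := x) (U₀ : TangentSpace I x)
  set U : Π x : M, TangentSpace I x := extend E (U₀ : TangentSpace I x) with hUdef
  have hUx : CMDiffAt 2 (T% U) x := (hU2 x hxu).contMDiffAt (hu.mem_nhds hxu)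
  have hU0 : U x = U₀ := by simp [hUdef]
  -- `f` is `C²`, hence differentiable, near `x`; `U` is differentiable near `x`
  have hfn : ∀ᶠ y in 𝓝 x, CMDiffAt 2 f y :=
    (contMDiffAt_iff_contMDiffAt_nhds (by simp)).1 hf
  have hUn : ∀ᶠ y in 𝓝 x, CMDiffAt 2 (T% U) y :=
    Filter.eventually_of_mem (hu.mem_nhds hxu) fun y hy ↦ (hU2 y hy).contMDiffAt (hu.mem_nhds hy)
  -- product rule near `x`: `[A, f U] = (A f) U + f [A, U]`
  have prodA : ∀ A : Π x : M, TangentSpace I x,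
      mlieBracket I A (f • U) =ᶠ[𝓝 x]
        (fun y ↦ mvfderiv I f y (A y)) • U + f • mlieBracket I A U := by
    intro A
    filter_upwards [hfn, hUn] with y hfy hUy
    rw [mlieBracket_smul_right (hfy.mdifferentiableAt two_ne_zero)
      (hUy.mdifferentiableAt two_ne_zero)]
    simp
  -- differentiability at `x` of the players
  have hfx : MDiffAt f x := hf.mdifferentiableAt two_ne_zero
  have hUx1 : MDiffAt (T% U) x := hUx.mdifferentiableAt two_ne_zero
  have hbr : ∀ {A B : Π x : M, TangentSpace I x}, CMDiffAt 2 (T% A) x → CMDiffAt 2 (T% B) x →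
      MDiffAt (T% (mlieBracket I A B)) x := fun hA hB ↦
    (ContMDiffAt.mlieBracket_vectorField (I := I) (m := 1) (n := 2) hA hB
      (by rw [minSmoothness_of_isRCLikeNormedField]; norm_num)).mdifferentiableAt one_ne_zero
  have hder : ∀ {A : Π x : M, TangentSpace I x}, CMDiffAt 2 (T% A) x →
      MDiffAt (fun y ↦ mvfderiv I f y (A y)) x := fun hA ↦
    (contMDiffAt_mvfderiv_apply hf (hA.of_le one_le_two)).mdifferentiableAt one_ne_zero
  -- expansion of `[A, [B, f U]] (x)`
  have expand : ∀ {A B : Π x : M, TangentSpace I x}, CMDiffAt 2 (T% A) x → CMDiffAt 2 (T% B) x →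
      mlieBracket I A (mlieBracket I B (f • U)) x =
        (mvfderiv I (fun y ↦ mvfderiv I f y (B y)) x (A x)) • U x
          + (mvfderiv I f x (B x)) • mlieBracket I A U x
          + (mvfderiv I f x (A x)) • mlieBracket I B U x
          + f x • mlieBracket I A (mlieBracket I B U) x := by
    intro A B hA hB
    rw [Filter.EventuallyEq.mlieBracket_vectorField_eq Filter.EventuallyEq.rfl (prodA B)]
    rw [mlieBracket_add_right ((hder hB).smul_section hUx1) (hfx.smul_section (hbr hB hUx))]
    rw [mlieBracket_smul_right (hder hB) hUx1, mlieBracket_smul_right hfx (hbr hB hUx)]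
    abel
  -- Jacobi identities at `x`
  have hV' : CMDiffAt (minSmoothness ℝ 2) (T% V) x := by rw [h2ms]; exact hV
  have hW' : CMDiffAt (minSmoothness ℝ 2) (T% W) x := by rw [h2ms]; exact hW
  have hU' : CMDiffAt (minSmoothness ℝ 2) (T% U) x := by rw [h2ms]; exact hUx
  have hfU' : CMDiffAt (minSmoothness ℝ 2) (T% (f • U)) x := by
    rw [h2ms]; exact hf.smul_section hUx
  have leib1 := leibniz_identity_mlieBracket_apply (I := I) hV' hW' hfU'
  have leib2 := leibniz_identity_mlieBracket_apply (I := I) hV' hW' hU'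
  -- `[[V, W], f U] (x)` by the product rule at `x`
  have prodx : mlieBracket I (mlieBracket I V W) (f • U) x =
      (mvfderiv I f x (mlieBracket I V W x)) • U x
        + f x • mlieBracket I (mlieBracket I V W) U x :=
    mlieBracket_smul_right hfx hUx1
  rw [expand hV hW, expand hW hV, prodx, leib2] at leib1
  -- compare the coefficients of `U x = U₀ ≠ 0`
  have key : (mvfderiv I (fun y ↦ mvfderiv I f y (W y)) x (V x)
      - mvfderiv I (fun y ↦ mvfderiv I f y (V y)) x (W x)
      - mvfderiv I f x (mlieBracket I V W x)) • U x = 0 := by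
    have h := sub_eq_zero.2 leib1
    calc _ = _ := by module
      _ = 0 := h
  rw [hU0] at key
  rcases smul_eq_zero.1 key with h | h
  · linarith
  · exact absurd h hU₀

namespace PseudoRiemannianMetric

variable (g : PseudoRiemannianMetric I n E (TangentSpace I : M → Type _))

/-! ## Differentiability of metric contractions -/

/-- The scalar function `y ↦ g_y(A_y, B_y)` is differentiable at `x` if the vector fields `A`, `B`
are differentiable at `x` (and `g` is `C^n`, `n ≥ 1`): the pseudo-Riemannian analogue of Mathlib's
`MDifferentiableAt.inner_bundle`, by `MDifferentiableAt.clm_bundle_apply₂`. [folklore] -/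
theorem mdifferentiableAt_val_apply [Fact (1 ≤ n)] {A B : Π x : M, TangentSpace I x}
    (hA : MDiffAt (T% A) x) (hB : MDiffAt (T% B) x) :
    MDiffAt (fun y ↦ g.val y (A y) (B y)) x := by
  have hn : (1 : ℕ∞ω) ≤ n := Fact.out
  have hg : MDifferentiableAt I (I.prod 𝓘(ℝ, E →L[ℝ] E →L[ℝ] ℝ))
      (fun b ↦ TotalSpace.mk' (E →L[ℝ] E →L[ℝ] ℝ) b (g.val b)) x :=
    (g.contMDiff x).mdifferentiableAt (by
      intro h
      simp [h] at hn)
  have : MDifferentiableAt I (I.prod 𝓘(ℝ, ℝ))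
      (fun y ↦ TotalSpace.mk' ℝ (E := Bundle.Trivial M ℝ) y (g.val y (A y) (B y))) x := by
    apply MDifferentiableAt.clm_bundle_apply₂ (F₁ := E) (F₂ := E)
    · exact hg
    · exact hA
    · exact hB
  simp only [mdifferentiableAt_totalSpace] at this
  exact this.2

/-- The scalar function `y ↦ g_y(A_y, B_y)` is `C^m` at `x` if the vector fields `A`, `B` are `C^m`
at `x` and `m ≤ n`: the pseudo-Riemannian analogue of Mathlib's `ContMDiffAt.inner_bundle`, by
`ContMDiffAt.clm_bundle_apply₂`. [folklore] -/
theorem contMDiffAt_val_apply {m : ℕ∞ω} (hm : m ≤ n) {A B : Π x : M, TangentSpace I x}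
    (hA : CMDiffAt m (T% A) x) (hB : CMDiffAt m (T% B) x) :
    CMDiffAt m (fun y ↦ g.val y (A y) (B y)) x := by
  have hg : ContMDiffAt I (I.prod 𝓘(ℝ, E →L[ℝ] E →L[ℝ] ℝ)) m
      (fun b ↦ TotalSpace.mk' (E →L[ℝ] E →L[ℝ] ℝ) b (g.val b)) x :=
    (g.contMDiff x).of_le hm
  have : ContMDiffAt I (I.prod 𝓘(ℝ, ℝ)) m
      (fun y ↦ TotalSpace.mk' ℝ (E := Bundle.Trivial M ℝ) y (g.val y (A y) (B y))) x := by
    apply ContMDiffAt.clm_bundle_apply₂ (F₁ := E) (F₂ := E)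
    · exact hg
    · exact hA
    · exact hB
  simp only [contMDiffAt_totalSpace] at this
  exact this.2

/-! ## The curvature of a metric connection is skew-adjoint -/

variable [CompleteSpace E]

variable {g} in
/-- **`g(R(X,Y)Z, Z) = 0` for a metric-compatible connection.** Let `∇ = cov` be a covariant
derivative on `TM` compatible with the `C^n` metric `g` (`g.IsCompatible cov`), `n ≥ 2`, and
locally `C¹` (`cov.IsLocallyContMDiff 1`). Then `g_x(R_x(X,Y)Z, Z) = 0` for its curvature tensor
`R = cov.curvature` (O'Neill 1983, Ch. 3, Prop. 3.36 (2), proof p. 75, which uses only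
compatibility (D5); Gallot–Hulin–Lafontaine 2004, Prop. 3.5 i)). Proof as printed: if `cov` has
no curvature tensor at `x` the value is the junk `0`; otherwise evaluate on the extended fields
`X, Y, Z` (`C²` near `x`), put `f = g(Z, Z)`, so that `A f = g(∇_A Z, Z) + g(Z, ∇_A Z)` near `x`
for every differentiable field `A` (compatibility), differentiate once more along `B`
(compatibility again, `∇_A Z` being differentiable at `x` by regularity) to get
`B(A f)(x) = 2 g(∇_B ∇_A Z, Z) + 2 g(∇_A Z, ∇_B Z)`, and subtract:
`2 g(R(X,Y)Z, Z) = X(Yf) - Y(Xf) - [X,Y]f = 0` by `mvfderiv_apply_mlieBracket`.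
[cite: ONeill1983, Ch. 3, Prop. 3.36 (2), p. 75] -/
theorem val_curvature_self_eq_zero {cov : CovariantDerivative I E (TangentSpace I : M → Type _)}
    (hc : g.IsCompatible cov) (hreg : cov.IsLocallyContMDiff 1) (hn : 2 ≤ n)
    (x : M) (X₀ Y₀ Z₀ : TangentSpace I x) :
    g.val x (cov.curvature x X₀ Y₀ Z₀) Z₀ = 0 := by
  by_cases h : cov.CurvatureTensorialAt x
  swap
  · rw [cov.curvature_of_not_curvatureTensorialAt h]
    simp
  rw [cov.curvature_apply_eq_extend h]
  -- Regularity of the extended fields: `C²` on a common open neighbourhood `u` of `x`.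
  have hI3 : IsManifold I (minSmoothness ℝ 3) M := by
    rw [minSmoothness_of_isRCLikeNormedField]; infer_instance
  obtain ⟨uX, huX, hxX, hX2⟩ := CovariantDerivative.exists_isOpen_contMDiffOn_extend (I := I) X₀
  obtain ⟨uY, huY, hxY, hY2⟩ := CovariantDerivative.exists_isOpen_contMDiffOn_extend (I := I) Y₀
  obtain ⟨uZ, huZ, hxZ, hZ2⟩ := CovariantDerivative.exists_isOpen_contMDiffOn_extend (I := I) Z₀
  set X := extend E X₀ with hXdef
  set Y := extend E Y₀ with hYdef
  set Z := extend E Z₀ with hZdef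
  set u := uX ∩ uY ∩ uZ with hudef
  have hu : IsOpen u := (huX.inter huY).inter huZ
  have hxu : x ∈ u := ⟨⟨hxX, hxY⟩, hxZ⟩
  have hX : CMDiff[u] 2 (T% X) := hX2.mono (fun y hy ↦ hy.1.1)
  have hY : CMDiff[u] 2 (T% Y) := hY2.mono (fun y hy ↦ hy.1.2)
  have hZ : CMDiff[u] 2 (T% Z) := hZ2.mono (fun y hy ↦ hy.2)
  have hcm : ∀ {A : Π x : M, TangentSpace I x}, CMDiff[u] 2 (T% A) →
      ∀ y ∈ u, CMDiffAt 2 (T% A) y :=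
    fun hA y hy ↦ (hA y hy).contMDiffAt (hu.mem_nhds hy)
  have hdiff : ∀ {A : Π x : M, TangentSpace I x}, CMDiff[u] 2 (T% A) →
      ∀ y ∈ u, MDiffAt (T% A) y :=
    fun hA y hy ↦ (hcm hA y hy).mdifferentiableAt two_ne_zero
  -- `g` is `C¹`, so that metric contractions of differentiable fields are differentiable.
  have hn1 : Fact (1 ≤ n) := ⟨one_le_two.trans hn⟩
  -- (1) The fields `∇_A B = fun y ↦ cov B y (A y)` are differentiable at `x`.
  have h1 : ∀ {A B : Π x : M, TangentSpace I x}, CMDiff[u] 2 (T% A) → CMDiff[u] 2 (T% B) →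
      MDiffAt (T% (fun y ↦ cov B y (A y))) x :=
    fun hA hB ↦ cov.mdifferentiableAt_cov_apply hreg hu hxu (hA.of_le one_le_two) hB
  -- (2) The function `f = g(Z, Z)` and its derivatives along differentiable fields.
  set f : M → ℝ := fun y ↦ g.val y (Z y) (Z y) with hfdef
  have h2 : ∀ {A : Π x : M, TangentSpace I x} {y : M}, y ∈ u → MDiffAt (T% A) y →
      mvfderiv I f y (A y) = g.val y (cov Z y (A y)) (Z y) + g.val y (Z y) (cov Z y (A y)) :=
    fun hy hA ↦ hc hA (hdiff hZ _ hy) (hdiff hZ _ hy)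
  -- (3) Hence `A f` agrees near `x` with `y ↦ g(∇_A Z, Z) + g(Z, ∇_A Z)` for `A` `C²` on `u`.
  have h3 : ∀ {A : Π x : M, TangentSpace I x}, CMDiff[u] 2 (T% A) →
      (fun y ↦ mvfderiv I f y (A y)) =ᶠ[𝓝 x]
        fun y ↦ g.val y (cov Z y (A y)) (Z y) + g.val y (Z y) (cov Z y (A y)) :=
    fun hA ↦ Filter.eventually_of_mem (hu.mem_nhds hxu) fun y hy ↦ h2 hy (hdiff hA y hy)
  -- (4) Second derivatives: `B(A f)(x) = 2 g(∇_B ∇_A Z, Z) + 2 g(∇_A Z, ∇_B Z)`.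
  have h4 : ∀ {A B : Π x : M, TangentSpace I x}, CMDiff[u] 2 (T% A) → CMDiff[u] 2 (T% B) →
      mvfderiv I (fun y ↦ mvfderiv I f y (A y)) x (B x) =
        2 * g.val x (cov (fun y ↦ cov Z y (A y)) x (B x)) (Z x)
          + 2 * g.val x (cov Z x (A x)) (cov Z x (B x)) := by
    intro A B hA hB
    have hS : MDiffAt (T% (fun y ↦ cov Z y (A y))) x := h1 hA hZ
    have hZx : MDiffAt (T% Z) x := hdiff hZ x hxu
    have hBx : MDiffAt (T% B) x := hdiff hB x hxu
    rw [mvfderiv_congr_of_eventuallyEq (h3 hA)]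
    rw [mvfderiv_fun_add (g.mdifferentiableAt_val_apply hS hZx)
      (g.mdifferentiableAt_val_apply hZx hS)]
    rw [add_apply, hc hBx hS hZx, hc hBx hZx hS]
    rw [g.symm x (Z x) (cov (fun y ↦ cov Z y (A y)) x (B x)),
      g.symm x (cov Z x (B x)) (cov Z x (A x))]
    ring
  -- (5) The bracket term: `[X, Y] f (x) = 2 g(∇_{[X,Y]} Z, Z)`.
  have hXx : CMDiffAt 2 (T% X) x := hcm hX x hxu
  have hYx : CMDiffAt 2 (T% Y) x := hcm hY x hxu
  have hZx2 : CMDiffAt 2 (T% Z) x := hcm hZ x hxu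
  have hI2 : IsManifold I (minSmoothness ℝ 2) M := by
    rw [minSmoothness_of_isRCLikeNormedField]; infer_instance
  have hI21 : IsManifold I (((2 : ℕ∞) : ℕ∞ω) + 1) M := IsManifold.of_le (n := ∞) (mod_cast le_top)
  have hBr : MDiffAt (T% (mlieBracket I X Y)) x :=
    (ContMDiffAt.mlieBracket_vectorField (I := I) (m := 1) (n := 2) hXx hYx
      (by rw [minSmoothness_of_isRCLikeNormedField]; norm_num)).mdifferentiableAt one_ne_zero
  have h5 : mvfderiv I f x (mlieBracket I X Y x) =
      2 * g.val x (cov Z x (mlieBracket I X Y x)) (Z x) := by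
    rw [h2 hxu hBr, g.symm x (Z x)]
    ring
  -- (6) The bracket acts on `f` as the commutator (`f` is `C²` at `x` since `n ≥ 2`).
  have hf2 : CMDiffAt 2 f x := g.contMDiffAt_val_apply hn hZx2 hZx2
  have h6 := mvfderiv_apply_mlieBracket hf2 hXx hYx
  -- (7) Combine.
  have eZ : Z x = Z₀ := by simp [hZdef]
  rw [← eZ]
  simp only [CovariantDerivative.curvatureAux, map_sub, sub_apply]
  have e1 := h4 hY hX
  have e2 := h4 hX hY
  rw [h5, e1, e2] at h6
  have es : g.val x (cov Z x (Y x)) (cov Z x (X x)) = g.val x (cov Z x (X x)) (cov Z x (Y x)) :=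
    g.symm x _ _
  linarith

variable {g} in
/-- **The curvature of a metric connection is skew-adjoint**: `g(R(X,Y)Z, W) = -g(R(X,Y)W, Z)`
for the curvature `R = cov.curvature` of a covariant derivative `cov` on `TM` compatible with the
`C^n` metric `g`, `n ≥ 2`, and locally `C¹` (O'Neill 1983, Ch. 3, Prop. 3.36 (2); Gallot–Hulin–
Lafontaine 2004, Prop. 3.5 i), second equality): polarization of `val_curvature_self_eq_zero` in
`Z`. [cite: ONeill1983, Ch. 3, Prop. 3.36 (2), p. 75] -/
theorem val_curvature_skew {cov : CovariantDerivative I E (TangentSpace I : M → Type _)}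
    (hc : g.IsCompatible cov) (hreg : cov.IsLocallyContMDiff 1) (hn : 2 ≤ n)
    (x : M) (X₀ Y₀ Z₀ W₀ : TangentSpace I x) :
    g.val x (cov.curvature x X₀ Y₀ Z₀) W₀ = -g.val x (cov.curvature x X₀ Y₀ W₀) Z₀ := by
  have h := val_curvature_self_eq_zero hc hreg hn x X₀ Y₀ (Z₀ + W₀)
  have hZ := val_curvature_self_eq_zero hc hreg hn x X₀ Y₀ Z₀
  have hW := val_curvature_self_eq_zero hc hreg hn x X₀ Y₀ W₀
  simp only [map_add, add_apply] at h
  linarith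

/-! ## Pair symmetry of the curvature and symmetry of the Ricci tensor -/

variable {g} in
/-- **Pair symmetry** `g(R(X,Y)Z, W) = g(R(Z,W)X, Y)` for the curvature of a torsion-free
covariant derivative compatible with the `C^n` metric `g`, `n ≥ 2`, and locally `C¹` (O'Neill 1983,
Ch. 3, Prop. 3.36 (4); Gallot–Hulin–Lafontaine 2004, Prop. 3.5 iii)): the printed algebraic
consequence of antisymmetry in `X, Y` (`CovariantDerivative.curvature_antisymm`),
skew-adjointness in `Z, W` (`val_curvature_skew`) and the first Bianchi identity
(`CovariantDerivative.curvature_first_bianchi`, which uses torsion-freeness; the manifold is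
smooth, so Mathlib's `minSmoothness ℝ 3` requirement is met) — add the Bianchi identities of the
four cyclic arrangements of `(X, Y, Z, W)`. [cite: ONeill1983, Ch. 3, Prop. 3.36 (4), pp. 75–76] -/
theorem val_curvature_pair_symm [FiniteDimensional ℝ E]
    {cov : CovariantDerivative I E (TangentSpace I : M → Type _)}
    (hc : g.IsCompatible cov) (hreg : cov.IsLocallyContMDiff 1) (ht : cov.torsion = 0)
    (hn : 2 ≤ n) (x : M) (X₀ Y₀ Z₀ W₀ : TangentSpace I x) :
    g.val x (cov.curvature x X₀ Y₀ Z₀) W₀ = g.val x (cov.curvature x Z₀ W₀ X₀) Y₀ := by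
  have hI3 : IsManifold I (minSmoothness ℝ 3) M := by
    rw [minSmoothness_of_isRCLikeNormedField]; infer_instance
  set R : TangentSpace I x → TangentSpace I x → TangentSpace I x → TangentSpace I x → ℝ :=
    fun a b c d ↦ g.val x (cov.curvature x a b c) d with hR
  have A : ∀ a b c d, R a b c d = -R b a c d := fun a b c d ↦ by
    simp only [hR]
    rw [cov.curvature_antisymm a b c, map_neg, neg_apply]
  have S : ∀ a b c d, R a b c d = -R a b d c := fun a b c d ↦
    val_curvature_skew hc hreg hn x a b c d
  have B : ∀ a b c d, R a b c d + R b c a d + R c a b d = 0 := fun a b c d ↦ by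
    simp only [hR]
    rw [← add_apply, ← add_apply, ← map_add, ← map_add, cov.curvature_first_bianchi hreg ht a b c,
      map_zero, zero_apply]
  change R X₀ Y₀ Z₀ W₀ = R Z₀ W₀ X₀ Y₀
  linarith [B X₀ Y₀ Z₀ W₀, B Y₀ Z₀ W₀ X₀, B Z₀ W₀ X₀ Y₀, B W₀ X₀ Y₀ Z₀,
      A X₀ Y₀ Z₀ W₀, A X₀ Y₀ W₀ Z₀, A X₀ Z₀ Y₀ W₀, A X₀ Z₀ W₀ Y₀, A X₀ W₀ Y₀ Z₀, A X₀ W₀ Z₀ Y₀,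
      A Y₀ X₀ Z₀ W₀, A Y₀ X₀ W₀ Z₀, A Y₀ Z₀ X₀ W₀, A Y₀ Z₀ W₀ X₀, A Y₀ W₀ X₀ Z₀, A Y₀ W₀ Z₀ X₀,
      A Z₀ X₀ Y₀ W₀, A Z₀ X₀ W₀ Y₀, A Z₀ Y₀ X₀ W₀, A Z₀ Y₀ W₀ X₀, A Z₀ W₀ X₀ Y₀, A Z₀ W₀ Y₀ X₀,
      A W₀ X₀ Y₀ Z₀, A W₀ X₀ Z₀ Y₀, A W₀ Y₀ X₀ Z₀, A W₀ Y₀ Z₀ X₀, A W₀ Z₀ X₀ Y₀, A W₀ Z₀ Y₀ X₀,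
      S X₀ Y₀ Z₀ W₀, S X₀ Y₀ W₀ Z₀, S X₀ Z₀ Y₀ W₀, S X₀ Z₀ W₀ Y₀, S X₀ W₀ Y₀ Z₀, S X₀ W₀ Z₀ Y₀,
      S Y₀ X₀ Z₀ W₀, S Y₀ X₀ W₀ Z₀, S Y₀ Z₀ X₀ W₀, S Y₀ Z₀ W₀ X₀, S Y₀ W₀ X₀ Z₀, S Y₀ W₀ Z₀ X₀,
      S Z₀ X₀ Y₀ W₀, S Z₀ X₀ W₀ Y₀, S Z₀ Y₀ X₀ W₀, S Z₀ Y₀ W₀ X₀, S Z₀ W₀ X₀ Y₀, S Z₀ W₀ Y₀ X₀,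
      S W₀ X₀ Y₀ Z₀, S W₀ X₀ Z₀ Y₀, S W₀ Y₀ X₀ Z₀, S W₀ Y₀ Z₀ X₀, S W₀ Z₀ X₀ Y₀, S W₀ Z₀ Y₀ X₀]


variable {g} in
/-- **The Ricci tensor of a torsion-free metric connection is symmetric** (O'Neill 1983, Ch. 3,
Lemma 3.52 ff.: a consequence of pair symmetry, Prop. 3.36 (4); Lee, *Riemannian Manifolds*,
Prop. 7.14). With `Ric(X, Y) = tr (v ↦ R(v, X) Y)` (`CovariantDerivative.ricci`) and a
`g_x`-orthogonal basis `b` (Mathlib's `LinearMap.BilinForm.exists_orthogonal_basis`),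
`Ric(X,Y) = Σ_i g(R(b_i,X)Y, b_i)/g(b_i,b_i)` and
`g(R(b,X)Y, b) = g(R(Y,b)b, X) = -g(R(b,Y)b, X) = g(R(b,Y)X, b)` by pair symmetry,
antisymmetry and skew-adjointness. [cite: ONeill1983, Ch. 3, Prop. 3.36 (4) and Lemma 3.52] -/
theorem ricci_isSymm_of_isCompatible [FiniteDimensional ℝ E]
    {cov : CovariantDerivative I E (TangentSpace I : M → Type _)}
    (hc : g.IsCompatible cov) (hreg : cov.IsLocallyContMDiff 1) (ht : cov.torsion = 0)
    (hn : 2 ≤ n) (x : M) : LinearMap.BilinForm.IsSymm (cov.ricci x) := by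
  classical
  haveI : FiniteDimensional ℝ (TangentSpace I x) := ‹FiniteDimensional ℝ E›
  set q : LinearMap.BilinForm ℝ (TangentSpace I x) := g.toBilinForm x with hqdef
  have hq : q.Nondegenerate := g.nondegenerate_toBilinForm x
  have hqs : q.IsSymm := g.isSymm_toBilinForm x
  obtain ⟨b, hb⟩ :=
    LinearMap.BilinForm.exists_orthogonal_basis (LinearMap.BilinForm.isSymm_iff.1 hqs)
  have hcq : ∀ i, q (b i) (b i) ≠ 0 := fun i ↦
    hb.not_isOrtho_basis_self_of_separatingLeft hq.1 i
  -- coordinates and traces in the orthogonal basis `b`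
  have hcoord : ∀ (v : TangentSpace I x) (i), b.repr v i = q v (b i) / q (b i) (b i) := by
    intro v i
    rw [eq_div_iff (hcq i)]
    conv_rhs => rw [← b.sum_repr v]
    rw [map_sum, LinearMap.sum_apply, Finset.sum_eq_single i]
    · rw [map_smul, LinearMap.smul_apply, smul_eq_mul]
    · intro j _ hji
      rw [map_smul, LinearMap.smul_apply, smul_eq_mul]
      have h := hb hji
      simp only [Function.onFun] at h
      rw [h, mul_zero]
    · intro hi
      exact absurd (Finset.mem_univ i) hi
  have htr : ∀ f : TangentSpace I x →ₗ[ℝ] TangentSpace I x, LinearMap.trace ℝ _ f =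
      ∑ i, q (f (b i)) (b i) / q (b i) (b i) := by
    intro f
    rw [LinearMap.trace_eq_matrix_trace ℝ b, Matrix.trace]
    simp only [Matrix.diag_apply, LinearMap.toMatrix_apply, hcoord]
  refine ⟨fun X₀ Y₀ ↦ ?_⟩
  rw [CovariantDerivative.ricci_apply, CovariantDerivative.ricci_apply, htr, htr]
  refine Finset.sum_congr rfl fun i _ ↦ ?_
  simp only [CovariantDerivative.ricciAux_apply, hqdef, toBilinForm_apply]
  rw [val_curvature_pair_symm hc hreg ht hn x (b i) X₀ Y₀ (b i),
    cov.curvature_antisymm Y₀ (b i) (b i), map_neg, neg_apply,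
    val_curvature_skew hc hreg hn x (b i) Y₀ (b i) X₀, neg_neg]


/-! ## The Levi-Civita connection: regularity (named fact), `g.riemann` skew, `Ric` symmetric -/

variable [FiniteDimensional ℝ E]

/-- **The Levi-Civita connection of a `C^n` metric is of class `C^{n-1}`.** Named fact: for
`k : ℕ∞` with `k + 1 ≤ n`, the Levi-Civita connection `g.leviCivita` of the `C^n` metric `g` is
locally `C^k` in the sense of `CovariantDerivative.IsLocallyContMDiff` (it maps `C^{k+1}` vector
fields on any open set `u` to `C^k` sections of `Hom(TM, TM)` on `u`, Mathlib's
`ContMDiffCovariantDerivativeOn`). In a chart `D_X Y = (X^j ∂_j Y^i + Γ^i_{jk} X^j Y^k) ∂_i`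
with the Christoffel symbols `Γ^i_{jk} = ½ g^{il} (∂_j g_{kl} + ∂_k g_{lj} - ∂_l g_{jk})`
(Gallot–Hulin–Lafontaine 2004, Prop. 2.54, valid for pseudo-Riemannian metrics by the Remark
after Def. 2.53), which are `C^{n-1}` functions of the `C^n` coefficients `g_{ij}`; the printed
sources work with smooth metrics (loc. cit., Thm. 2.51), the finite-regularity count being read
off the formula. Stated, like the facts of `LeviCivita.lean`, with the instances of the
Levi-Civita API bound inside; `k = ω` is excluded (on a merely smooth manifold analytic
regularity is not preserved). [cite: GallotHulinLafontaine2004, Prop. 2.54] -/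
def isLocallyContMDiff_leviCivita : Prop :=
  ∀ [Fact (1 ≤ n)] [FiniteDimensional ℝ E] [CompleteSpace E] [g.HasLeviCivita] (k : ℕ∞),
    (k : ℕ∞ω) + 1 ≤ n → g.leviCivita.IsLocallyContMDiff k

variable [Fact (1 ≤ n)] [g.HasLeviCivita]

/-- **The Riemann tensor is skew-adjoint in its last slot**: `g(R(X,Y)Z, W) = -g(R(X,Y)W, Z)`
for `g.riemann` of a `C^n` metric, `n ≥ 2` (O'Neill 1983, Ch. 3, Prop. 3.36 (2); Gallot–Hulin–
Lafontaine 2004, Prop. 3.5 i)), from the named facts `isLeviCivita_leviCivita` (of which only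
compatibility is used) and `isLocallyContMDiff_leviCivita` (with `k = 1`), by
`val_curvature_skew`. This is the statement `riemann_skew` assumed by the dimension-three step of
`PositiveMassRigidity.lean`. [cite: ONeill1983, Ch. 3, Prop. 3.36 (2), p. 75] -/
theorem val_riemann_skew_of_facts (hLC : g.isLeviCivita_leviCivita)
    (hreg : g.isLocallyContMDiff_leviCivita) (hn : 2 ≤ n)
    (x : M) (X₀ Y₀ Z₀ W₀ : TangentSpace I x) :
    g.val x (g.riemann x X₀ Y₀ Z₀) W₀ = -g.val x (g.riemann x X₀ Y₀ W₀) Z₀ := by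
  have hc : g.IsCompatible g.leviCivita := (hLC : g.IsLeviCivita g.leviCivita).2
  have h1 : g.leviCivita.IsLocallyContMDiff 1 := hreg 1 (by
    have : ((1 : ℕ∞) : ℕ∞ω) + 1 = 2 := by norm_num
    rw [this]; exact hn)
  exact val_curvature_skew hc h1 hn x X₀ Y₀ Z₀ W₀

omit [CompleteSpace E] [FiniteDimensional ℝ E] [Fact (1 ≤ n)] [g.HasLeviCivita] in
/-- **Discharge of `ricci_symm` down to the Levi-Civita facts**: the named fact
`PseudoRiemannianMetric.ricci_symm` of `LeviCivita.lean` (the Ricci tensor of a `C²` metric is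
symmetric; O'Neill 1983, Ch. 3, Lemma 3.52) follows from `isLeviCivita_leviCivita`
(torsion-freeness and compatibility) and `isLocallyContMDiff_leviCivita` (with `k = 1`), by
`ricci_isSymm_of_isCompatible`. [cite: ONeill1983, Ch. 3, Prop. 3.36 (4) and Lemma 3.52] -/
theorem ricci_symm_of_facts (hLC : g.isLeviCivita_leviCivita)
    (hreg : g.isLocallyContMDiff_leviCivita) : g.ricci_symm := by
  intro _ _ _ _ hn x
  have h : g.IsLeviCivita g.leviCivita := hLC
  have h1 : g.leviCivita.IsLocallyContMDiff 1 := hreg 1 (by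
    have : ((1 : ℕ∞) : ℕ∞ω) + 1 = 2 := by norm_num
    rw [this]; exact hn)
  exact ricci_isSymm_of_isCompatible h.2 h1 h.1 hn x

/-! ## Symmetry of the Hessian from torsion-freeness -/

omit [Fact (1 ≤ n)] in
/-- **The Hessian of a `C²` function is symmetric when the connection is torsion-free.** If the
Levi-Civita connection `g.leviCivita` has vanishing torsion, then `g.hessian f x` is symmetric for
every `f` of class `C²` at `x` (O'Neill 1983, Ch. 3, Lemma 3.49: `H^f(X,Y) = XYf - (∇_X Y)f` is
symmetric "since `∇_X Y - ∇_Y X = [X, Y]`"). Proof as printed: if no bilinear form represents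
`hessianAux` on extended vectors the Hessian is the junk `0`; otherwise, on the extended fields
`X, Y` (`C²` at `x`), `H(X,Y) - H(Y,X) = (X(Yf) - Y(Xf)) - df(∇_X Y - ∇_Y X) = [X,Y]f - [X,Y]f = 0`
by `mvfderiv_apply_mlieBracket` and Mathlib's `CovariantDerivative.torsion_eq_zero_iff`.
[cite: ONeill1983, Ch. 3, Lemma 3.49] -/
theorem hessian_isSymm_of_torsion_eq_zero (ht : g.leviCivita.torsion = 0) {f : M → ℝ}
    (hf : CMDiffAt 2 f x) : (g.hessian f x).IsSymm := by
  classical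
  by_cases h : ∃ B : LinearMap.BilinForm ℝ (TangentSpace I x), ∀ X₀ Y₀ : TangentSpace I x,
      B X₀ Y₀ = g.hessianAux f (extend E X₀) (extend E Y₀) x
  swap
  · have h0 : g.hessian f x = 0 := by simp only [hessian, dif_neg h]
    rw [h0]
    exact ⟨fun _ _ ↦ rfl⟩
  have hB : g.hessian f x = h.choose := by simp only [hessian, dif_pos h]
  rw [hB]
  refine ⟨fun X₀ Y₀ ↦ ?_⟩
  rw [h.choose_spec, h.choose_spec]
  simp only [hessianAux]
  have hX : CMDiffAt 2 (T% (extend E X₀)) x := contMDiffAt_extend (I := I) (F := E) (k := 2) X₀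
  have hY : CMDiffAt 2 (T% (extend E Y₀)) x := contMDiffAt_extend (I := I) (F := E) (k := 2) Y₀
  have hbr := mvfderiv_apply_mlieBracket hf hX hY
  have htf := g.leviCivita.torsion_eq_zero_iff.1 ht (hX.mdifferentiableAt two_ne_zero)
    (hY.mdifferentiableAt two_ne_zero)
  have hdf := congrArg (mvfderiv I f x) htf
  rw [map_sub] at hdf
  simp only [extend_apply_self] at hbr hdf ⊢
  linarith

omit [CompleteSpace E] [FiniteDimensional ℝ E] [Fact (1 ≤ n)] [g.HasLeviCivita] in
/-- **Discharge of `hessian_symm` down to the Levi-Civita existence fact**: the named fact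
`PseudoRiemannianMetric.hessian_symm` of `LeviCivita.lean` (O'Neill 1983, Ch. 3, Lemma 3.49)
follows from `isLeviCivita_leviCivita` (of which only torsion-freeness is used), by
`hessian_isSymm_of_torsion_eq_zero`. [cite: ONeill1983, Ch. 3, Lemma 3.49] -/
theorem hessian_symm_of_isLeviCivita (hLC : g.isLeviCivita_leviCivita) : g.hessian_symm := by
  intro _ _ _ _ x f hf
  exact g.hessian_isSymm_of_torsion_eq_zero (hLC : g.IsLeviCivita g.leviCivita).1 hf

/-- Sanity check: the named fact binds its instances and excludes `k = ω`. -/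
example : g.isLocallyContMDiff_leviCivita ↔
    ∀ [Fact (1 ≤ n)] [FiniteDimensional ℝ E] [CompleteSpace E] [g.HasLeviCivita] (k : ℕ∞),
      (k : ℕ∞ω) + 1 ≤ n → g.leviCivita.IsLocallyContMDiff k := Iff.rfl

end PseudoRiemannianMetric

end Literature.Geometry.Lorentzian

end
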